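/-
Copyright: publication-cell `pub-balaban` (b2b), seat b2b-balaban-b10 gen 25 (v1).  Literature leaf — the exponential
of a unital C⋆-algebra (norm bookkeeping of `exp(B)·U` against unitaries, `exp` a local homeomorphism at `0`), linear
maps in finitely many variables, and one-line applications of the lineage's landed theorems only; every theorem is
kernel-proved and tagged [folklore] or [cite: …] (a LOCATED printed shape); the objects are MODEL OBJECTS (the sibling
interfaces `Tube`, `TubeCfg`, `gaugeAct`, `expLine`, `diffAlongV`, `LogHalfBound`, `Bound118`), never asserted to be
Bałaban's; NO new cited facts, NO summit vocabulary.
-/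
import Mathlib
import Literature.MathematicalPhysics.QuantumFieldTheory.Balaban1983to89.B10Eq26TubeIdentity
import Literature.MathematicalPhysics.QuantumFieldTheory.Balaban1983to89.B13Inv214Orbit
import Literature.Analysis.Calculus.ExpDuhamel

/-!
# `Balaban1983to89.B10Eq26SiteGauge` — [Balaban1985UV3] (26) p. 263 *"for all gauge transformations 𝓊"* READ FOR
# SITE-DEPENDENT TRANSFORMATIONS in the lineage's tube model: unitary-valued (`G`-valued) transformations act on the
# bondwise tube EXACTLY, `Gᶜ`-valued ones near `G` act WITH MARGINS — b13's located binder `hmaps` ([I] p. 276 *«so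
# that the configurations after the transformations belong to proper spaces also»*) is DISCHARGED on the tube model
# (for every target half-width `a > 0` there are `a₀, c > 0` such that every transformation of the `c`-tube maps the
# `a₀`-tube of configurations into the `a`-tube) — so [I] (1.19) near `G`, i.e. [II] p. 21 *«extended, by the
# analyticity, to Gᶜ-valued gauge transformations in a small neighborhood of the space of G-valued ones»*, holds on
# the tube model from (26) + holomorphy ALONE, neighbourhoods PRODUCED; and (29) p. 263 is TYPED: (26) + the
# localization property + the printed gauge-fixing datum give `𝒫′₁(g₀, X, U₁) = 𝒫′₁(g₀, X, exp i𝓗(B))`, whence the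
# lineage's model difference `diffAlongV E (expLine gen 1)` IS the printed difference `𝒫′₁(g₀, X, U₁) − 𝒫′₁(g₀, X, 1)`
# of (30), (61), and the joint theorems are restated on that difference

T. Bałaban, *Ultraviolet stability of three-dimensional lattice pure gauge field theories*, Commun. Math. Phys.
**102**, 255–275 (1985) [Balaban1985UV3] (cell paper B10; PDF `paper:balaban1985-cmp102-uv-stability-3d`, journal page
= PDF page + 254); T. Bałaban, *Renormalization group approach to lattice gauge field theories. I*, Commun. Math.
Phys. **109**, 249–301 (1987) [Balaban1987RG1] = [I]; *… II. Cluster expansions*, Commun. Math. Phys. **116**, 1–22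
(1988) [Balaban1988RG2Cluster] = [II]; T. Bałaban, *Propagators for lattice gauge theories in a background field*,
Commun. Math. Phys. **99**, 389–434 (1985) [Balaban1985BackgroundPropagators] = [13] of [II].

CITATION HEADER (lean-in-tree rule).  Every quotation below marked «re-keyed» is copied byte-for-byte (whitespace
re-flowed) from the §0 / header of a tree module of this cell which read it AS IMAGE from the named render:
`…B10Eq26MeasureInv` and `…B10Eq26TubeIdentity` (B10 pp. 262–264; renders
`b2b-balaban-ref1/pages/1985-cmp102-uv-stability-3d/…-p008-x4.png`, `…-p009-x4.png`, `…-p010`), `…B10Eq31GlobalConj`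
(B10 p. 264, [I] pp. 262, 263, 283), `…B10Eq61PerSite` (B10 pp. 263, 271), `…B13GaugeDevices` / `…B13Inv214Orbit`
([I] p. 276, [II] pp. 21–22, [13] p. 395).  ONE passage is quoted NEW, READ AS IMAGE for this module from the render
`…/1985-cmp102-uv-stability-3d-p009-x2.png` (journal p. 263, the paragraph after (26) up to (27), and the displayed
formula (30)), and B10's reference [7] is IDENTIFIED from the render `…-p020-x2.png` (journal p. 274, reference list,
read as image): *"7. Balaban, T.: The variational problem and background fields in renormalization group method for
lattice gauge theories. Commun. Math. Phys. (in press)"* = [Balaban1985Variational] (cell paper B11, Commun. Math.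
Phys. **102**, 277–309 (1985)).  This module adds NO cited fact; the manuscripts under audit are quoted for the SHAPES
of hypotheses, never cited for a disputed step.  Siblings imported BY NAME (byte-identical, nothing edited):
`…B10Eq26TubeIdentity` (b10 gen 24: `tubeIdentity`, `eqOn_tubeCfg_of_eqOn_unitary`, the three joint theorems
`logHalfBound_expLine_of_unitaryClassFn`, `logHalfBound_expLine_cplx_of_unitaryClassFn`,
`bound118_secondOrder_expLine_cplx_of_unitaryClassFn`; through it `Tube`, `TubeCfg`, `expLine`, `expLine_zero`,
`mem_tubeCfg_of_unitary` of `…B10Eq29TubeLine`, `conj_mem_tube`, `commSpan` of `…B10Eq31GlobalConj`,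
`map_exp_nhds_zero` of `…B10Eq61Leaves`, `diffAlongV`, `unitSys` of `…B10Eq61PerSite`, `LogHalfBound`, `Bound118`,
`VolBoundK1`, `Consts` of `…B13`), `…B13Inv214Orbit` (b13 gen 20: `Ends`, `gaugeAct`, `gaugeAct_eq_star`,
`gaugeAct_one`, `gcInvariant_of_analyticOn`, `NearOrbitConstOn`, `nearOrbitConstOn_of_analyticOn`, `toyEnds`,
`toy_gaugeAct`), and the tree's [folklore] leaf `Literature.Analysis.Calculus.ExpDuhamel` (`norm_exp_sub_one_le :
‖exp a − 1‖ ≤ e^{‖a‖} − 1`, used by name; the `ℚ`-algebra structure it wants is threaded by `letI` inside proofs, no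
global instance).

WHY THIS MODULE (the open edges it closes, by name).  (a) `…B13Inv214Orbit` ([II] pp. 21–22 typed) carries, besides
(H6) `hId` (discharged by `tubeIdentity`, gen 24), the binder `hmaps : ∀ u ∈ TubeCfg S 𝔸 a, gaugeAct γ u V ∈ 𝒟` —
[I] p. 276's proviso, «NOT discharged» (its HONEST SCOPE (ii); cell GAPS C-B13-44).  On the lineage's model domain
`𝒟 = TubeCfg ι 𝔸 a` this is a statement about exponentials and unitaries in a C⋆-algebra, and §3 PROVES it, with the
neighbourhoods produced (`exists_mapsTube`).  (b) `…B10Eq26TubeIdentity` HONEST SCOPE (ii) and `…B10Eq31GlobalConj`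
HONEST SCOPE (ii): «site-dependent transformations and that holomorphy are NOT modelled by the lineage (constant
transformations only)» — whereas B10 states (26) *"for all gauge transformations 𝓊"* and USES a site-dependent one in
the very next paragraph (the gauge fixing before (29)).  §2, §4 model them (`SiteGaugeInv`), show that p. 264's
sentence «(26) implies the invariance with respect to the global transformations» is the specialization `u ≡ W`
(`conjInv_of_siteGaugeInv`), and continue (26) in the configuration variable to the tube for every unitary-valued `u`
(`siteGaugeInv_tube`).  (c) `…B10Eq61PerSite` HONEST SCOPE: the line `ζ ↦ exp iζη𝓗(B)` and its gauge are «a datum»;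
the lineage's joint theorems bound the MODEL difference `diffAlongV E (expLine gen 1) X φ = E X (exp(gen X φ)) − E X 1`,
and the identification of its first term with `E X φ` — print's (29) — was never typed.  §6 types it from (26) +
localization + the gauge-fixing datum, in an abstract form that serves real (unitary-valued) and complex (tube-valued)
configurations alike, and §7 restates the three joint theorems of gen 24 on `E X φ − E X 1`.

WHAT IS PRINTED (verbatim).
* B10 pp. 262–263 («re-keyed»): *"equalities hold 𝒫′₁(g₀, X, U₁ᵘ) = 𝒫′₁(g₀, X, U₁), (26) for all gauge transformations
  𝓊. The second is a localization property with respect to U₁. The expression 𝒫′₁(g₀, X, U₁) depends on U₁ restricted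
  to the set X̃⁵ (let us recall that X̃⁵ = ∪_{□⊂X} □̃⁵). The third property is the analyticity with respect to U₁."*
* B10 p. 263, the next paragraph (NEW, read as image from `…-p009-x2.png`): *"Now we are ready to perform the most
  important operation, a renormalization of the interaction terms 𝒫′₁. Let us consider a term 𝒫′₁(g₀, X, U₁). The
  localization domain X is contained in a cube □ of the size RM₁. We may assume that X̃⁵ ⊂ □ also, and a center of □
  belongs to X. We apply the constructions and results of Sect. F [7]. According to these there exists a gauge
  transformation in a neighbourhood of □₁, where □₁ is a cube of the size 3RM₁ and with the same center as □, such
  that the gauge transformed U₁ is represented as exp i𝓗(B) in the neighbourhood of □₁. The function 𝓗(B) is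
  represented as 𝓗(B) = HB + A₁, where HB corresponds to a linearized theory, and A₁ is a non-linear perturbation
  determined by Eq. (158) [7]. Let us explain now the configuration B, which plays an important role in our
  considerations. Let y denote the center of □. The configuration B restricted to □₁ is defined on □₁⁽¹⁾ = □₁ ∩ T⁽¹⁾
  and for a bond c of this set is given by B(c) = (1/i) log V(Γ_{y,c₋} ∪ c ∪ Γ_{c₊,y}). (27)"* — so (27) is the
  DEFINITION of the configuration `B` (and (28) its bound); the gauge fixing is the sentence citing Sect. F of [7].
* B10 p. 263 («re-keyed»): *"By the gauge invariance (26), we have 𝒫′₁(g₀, X, U₁) = 𝒫′₁(g₀, X, exp i𝓗(B)), (29) and we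
  expand the function with respect to 𝓗(B)."*; (30) (read as image, same render; re-keyed in linear notation):
  *"𝒫′₁(g₀, X, exp i𝓗(B)) = 𝒫′₁(g₀, X, 1) + ⟨(δ𝒫′₁⁄δ𝓗)(g₀, X, 1), 𝓗(B)⟩ + Σ_{n=2}^{6} (1⁄n!)⟨(δⁿ𝒫′₁⁄δ𝓗ⁿ)(g₀, X, 1),
  ⊗ⁿ𝓗(B)⟩ + O(g₀⁷)e^{−κ𝓛(X)}. (30)"* — the expansion is AROUND THE CONFIGURATION `1`, whose value `𝒫′₁(g₀, X, 1)` is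
  the zeroth-order term.
* B10 p. 264 («re-keyed»): *"The gauge invariance (26) implies the invariance with respect to the global transformations
  R(U), U ∈ G, hence the equality R(U)((δ/δ𝓗(b))𝒫′₁)(g₀, X, 1) = ((δ/δ𝓗(b))𝒫′₁)(g₀, X, 1). (31) We have to notice
  only that (26) holds for all regular gauge field configurations, not only for the minimal configurations U₁."*
* B10 p. 271 («re-keyed»): *"representation U_{k+1} = exp iη𝓗(B) (modulo a gauge transformation) in a neighbourhood of
  □₁. …"*; *"we obtain the inductive inequality (41) for k replaced by k + 1, but with the additional term
  log Z^{(k)}(B(Λ_{k+1}), U_{k+1}) − log Z^{(k)}(B(Λ_{k+1}), 1). (61)"*.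
* [13] p. 395 (3.28) («re-keyed»): *«U → Uᵘ, U′ → R(u)U′, where Uᵘ(x, x′) = u(x)U(x, x′)u⁻¹(x′), (R(u)U′)(x, x′) =
  R(u(x))U′(x, x′)»* — the formula of the action (`B13Inv214Orbit.gaugeAct`, with `u⁻¹`).
* [I] p. 262 («re-keyed»): *"(i) 𝐔 = U′U, U has values in the group G, |∂U − 1| < α₀ξ² on X, (1.11) for each cube □ ⊂ X
  of a size O(1)LM there exists a G-valued gauge transformation u defined on □ and such, that Uᵘ = exp iξA, |A|,
  |∇^ξA| < O(1)LMBα₀ on □, (1.12) with a sufficiently large constant B (it will be determined later). (ii) U′ = exp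
  iξA′, A′ has values in the algebra gᶜ, |A′|, |∇^ξ_U A′| < α₁ on X. (1.13)"*
* [I] p. 263 («re-keyed»): *"Explicitly 𝐄⁽ʲ⁾(X, g_{j−1}, 𝐔ᵘ, R(u)𝐉) = 𝐄⁽ʲ⁾(X, g_{j−1}, 𝐔, 𝐉) (1.19) for all Gᶜ-valued
  gauge transformations u. The spaces Uᶜ_j(X, α₀, α₁) are, by the definition, gauge invariant also."*
* [I] p. 276 («re-keyed»): *«The functions (3.25), (3.26) are gauge invariant with respect to the simultaneous gauge
  transformations U → Uᵘ, J → R(u)J, B → R(u)B, (3.29) for Gᶜ-valued transformations u in a sufficiently small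
  neighborhood of G-valued transformations, so that the configurations after the transformations belong to proper
  spaces also.»*
* [I] p. 283 («re-keyed»): *"We assume the gauge invariance with respect to Gᶜ-valued gauge transformations, but it is
  implied by the invariance with respect to G-valued transformations, and by the analyticity of the function, as it
  was noticed already."*
* [II] p. 21 («re-keyed»): *«the expressions (2.14) are gauge invariant with respect to all G-valued transformations.
  The expressions are analytic functions of (U, J), hence the invariance can be extended, by the analyticity, to
  Gᶜ-valued gauge transformations in a small neighborhood of the space of G-valued ones.»*

THE MATHEMATICS ([folklore]; two remarks).  (M1) MARGINS.  A bond variable of the `a₀`-tube is `exp(B)·U`, `‖B‖ <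
a₀`, `U` unitary; a transformation of the `c`-tube has `u(x) = exp(C_x)·w_x`, `‖C_x‖ < c`, `w_x` unitary, and
`u(x)⁻¹ = w_x⋆·exp(−C_x)`.  The transformed bond variable `exp(C₁)w₁ · exp(B)U · w₂⋆exp(−C₂)` differs from the UNITARY
`w₁Uw₂⋆` by `(x − x₀)yz + x₀(y − y₀)z + x₀y₀(z − z₀)`, of norm `≤ (e^{c} − 1)e^{a₀}e^{c} + (e^{a₀} − 1)e^{c} + (e^{c} −
1) = e^{c + a₀ + c} − 1` (unitary factors are free in a C⋆-norm; `‖exp X − 1‖ ≤ e^{‖X‖} − 1`).  And there is ONE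
radius `δ = δ(a) > 0` such that everything within `δ` of ANY unitary `U′` lies in the `a`-tube: `exp` maps
`𝓝 0` onto `𝓝 1` (inverse function theorem, the tree's `map_exp_nhds_zero`), so `ball 1 δ ⊆ exp(ball 0 a)` for some
`δ`, and `V = (V·U′⋆)·U′` with `V·U′⋆ ∈ ball 1 δ` when `‖V − U′‖ < δ`.  Hence `e^{2c + a₀} − 1 ≤ δ(a)` gives the margin
property, and `a₀ = c = min(1/3, δ/7)` will do (`e^{3s} − 1 ≤ 6s` for `0 ≤ 3s ≤ 1`).  The radius is not made explicit
(no logarithm series is used); the toy of §8 shows that SOME margin is necessary (`c = a` fails already for `𝔸 = ℂ`).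
(M2) (29) IS THREE HYPOTHESES AND ONE LINE: if `E X` is invariant under an admissible class of transformations at the
points of the space (the relevant reading of (26)), depends on the configuration only through the bonds of a set
`dep X` ("X̃⁵"), and the configuration `φ` is carried by an admissible transformation to one that equals `exp(gen X φ)`
on `dep X` (the gauge-fixing datum, "exp i𝓗(B) in the neighbourhood of □₁ ⊇ X̃⁵"), then `E X φ = E X (φᵘ) =
E X (exp(gen X φ))`.  For REAL configurations the admissible class is the unitary-valued transformations and the
invariance is (26) itself; for the COMPLEX tube it is the `c`-tube of transformations and the invariance is the
continued one of (M1) + [II] p. 21 — this is where the margins are consumed.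

WHAT IS KERNEL-CERTIFIED.
(§1) TUBE GEOMETRY [folklore]: `norm_le_one_of_mem_unitary`; `norm_exp_mul_sub_le` / `norm_mul_exp_sub_le` (`‖exp(B)U
  − U‖, ‖U exp(B) − U‖ ≤ e^{‖B‖} − 1`); `norm_exp_mul_le` / `norm_mul_exp_le` (`≤ e^{‖B‖}`, no `‖1‖ = 1` needed);
  `norm_lt_exp_of_mem_tube` (`‖V‖ < e^{a}` on the `a`-tube, STRICT and without `[Nontrivial 𝔸]`);
  `exists_unitary_norm_sub_lt_of_mem_tube` (every tube point is within `e^{a₀} − 1` of a unitary); the UNIFORM radius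
  `exists_ball_one_subset_exp_image` (`∃ δ > 0, ball 1 δ ⊆ exp '' ball 0 a`) and `mem_tube_of_norm_sub_lt` (within `δ`
  of some unitary ⇒ in the `a`-tube).
(§2) THE ACTION IN THE CONFIGURATION VARIABLE [folklore]: `mul_mem_tube_of_mem_unitary`, `unitary_mul_mem_tube`
  (`w₁·V·w₂⋆` stays in the SAME tube), hence `gaugeAct_mem_tubeCfg_of_unitary` (unitary-valued site-dependent `u`
  preserve `TubeCfg ι 𝔸 a` exactly) and `gaugeAct_unitary_of_unitary` (and the unitary-valued configurations);
  `gaugeAct_const` (constant `u ≡ W` is the global conjugation `V_b ↦ W V_b W⋆`); `differentiable_gaugeAct_cfg` (`V ↦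
  𝐕ᵘ` is ℂ-differentiable — it is linear — for every `u`, `[Fintype ι]`).
(§3) MARGINS = b13's `hmaps` ON THE TUBE MODEL: the shape `MapsTube 𝔸 γ a a₀ c := ∀ u ∈ TubeCfg S 𝔸 c, ∀ V ∈ TubeCfg
  ι 𝔸 a₀, gaugeAct γ u V ∈ TubeCfg ι 𝔸 a`; `tubeCfg_subset_of_mapsTube` (`c > 0` ⇒ the `a₀`-tube sits in the `a`-tube);
  `inverse_exp_mul_unitary` (`(exp(C)w)⁻¹ = w⋆exp(−C)` as `Ring.inverse`); the three-factor estimate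
  `norm_gaugeBond_sub_le`; `mapsTube_of_margin` (`ball 1 δ ⊆ exp(ball 0 a)` and `e^{c + a₀ + c} − 1 ≤ δ` ⇒ `MapsTube`);
  `exists_mapsTube` (`∀ a > 0, ∃ a₀ > 0, ∃ c > 0, MapsTube 𝔸 γ a a₀ c`).
(§4) (26) SITE-DEPENDENT: the hypothesis shape `SiteGaugeInv γ F := ∀ u, (∀ x, u x ∈ unitary 𝔸) → ∀ V, (∀ b, V b ∈
  unitary 𝔸) → F (gaugeAct γ u V) = F V`; `conjInv_of_siteGaugeInv` (⇒ the lineage's constant-`W` binder `h26` of gen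
  24, p. 264's sentence); `siteGaugeInv_tube` (holomorphic on the `a`-tube + `SiteGaugeInv` ⇒ `F (gaugeAct γ u V) = F V`
  for every unitary-valued `u` and every `V` of the tube: `eqOn_tubeCfg_of_eqOn_unitary` applied to `F ∘ (·)ᵘ` and `F`).
(§5) THE JOIN ([I] (1.19) near `G` on the tube model, b13's `hId` AND `hmaps` discharged): `gcInvariant_tube` (`c > 0`,
  `MapsTube 𝔸 γ a a₀ c`, `F` holomorphic on the `a`-tube, `SiteGaugeInv γ F` ⇒ `F (gaugeAct γ u V) = F V` for all `u`
  of the `c`-tube and `V` of the `a₀`-tube — `B13Inv214Orbit.gcInvariant_of_analyticOn` fed with `tubeIdentity c`, the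
  margins, and §4); the hypothesis-free packaging `exists_gcInvariant_tube` (`∀ a > 0 ∃ a₀ c > 0 ∀ F …`); b13's (R3)-input
  on the model space, `nearOrbitConstOn_tube : NearOrbitConstOn γ c F (TubeCfg ι 𝔸 a₀)`.
(§6) (29) TYPED: `expLine_one_one` (the line with base `1` at `ζ = 1` is `exp(gen X φ)`); `eq29_of_gaugeFix` (abstract
  admissible class `P X`: localization `hloc` + invariance `hinv` + gauge-fixing datum `hfix` ⇒ `E X φ = E X (expLine gen
  1 X φ 1)` on `sp' X`); its two instances `eq29_of_unitaryGaugeFix` (real: `hinv` := (26)) and `eq29_of_tubeGaugeFix`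
  (complex: `hinv` := §5, `[Fintype ι] [Fintype S]`, margins, `sp' X ⊆ a₀`-tube, `u` in the `c`-tube — a unitary-valued
  datum is a special case, `tubeGaugeFix_of_unitaryGaugeFix`); `diffAlongV_eq_sub` ((29) ⇒ `diffAlongV E (expLine gen 1)
  X φ = E X φ − E X 1` on `sp' X`); the transports `logHalfBound_congr`, `bound118_congr`.
(§7) THE JOINT THEOREMS OF GEN 24 ON THE PRINTED DIFFERENCE `fun X φ => E X φ − E X (fun _ => 1)`, binder `h26 : ∀ X,
  SiteGaugeInv γ (E X)` ((26) as printed, all gauge transformations, on unitary-valued configurations) in place of the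
  constant-`W` binder, plus `hloc` and the gauge-fixing datum; every other binder, constant and rate VERBATIM from
  `…B10Eq26TubeIdentity` §4: `logHalfBound_sub_of_siteGaugeInv` (real backgrounds; `8((p + q)/a)²·B`, `r − 2`),
  `logHalfBound_sub_cplx_of_siteGaugeInv` (complex; `8·((2p + q)/(min(1/8, a/2) − p))²·B`, `r − 2`; margins `hc`,
  `hmaps`, `hT`), `bound118_sub_cplx_of_siteGaugeInv` ((I.1.18)-type with [II]'s letters and printed R21; `(64A(1 +
  c₀²)/(min(1/8, a/2) − α₁)²)·c₁`, `r − 3`).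
(§8) NON-VACUITY / SHARPNESS: (T1) `toy_not_mapsTube` — `𝔸 = ℂ`, one bond from site `true` to site `false`
  (`B13Inv214Orbit.toyEnds`): `u = (e^{a/2}, e^{−a/2})` lies in the `a`-tube and maps `V ≡ 1` to `e^{a} ∉ Tube ℂ a`, so
  `MapsTube ℂ toyEnds a a₀ a` FAILS for all `a, a₀ > 0` (the transformation tube must be thinner than the target tube),
  while `exists_mapsTube` provides margins for the same toy (an `example`); (T2) `toy_axial_gaugeFix` — on the one-bond
  lattice every unitary configuration is gauged to `1 = exp 0` by `u(true) = 1, u(false) = V_b` (axial gauge on a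
  tree), so the datum `hfix` of §6 is satisfiable with `gen = 0`, and the closing `example` runs `eq29_of_unitaryGaugeFix`
  on `B10Eq61PerSite.unitSys`: a (26)-invariant family is CONSTANT (= its value at `1`) on unitary one-bond
  configurations — (29) with content; (T3) `toy_axial_tubeGaugeFix` — the same axial transformation gauges a one-bond
  configuration of the `c`-tube to `1` and lies itself in the `c`-tube, so the TUBE-valued datum of
  `eq29_of_tubeGaugeFix` is satisfiable with `a₀ = c`, the shape `exists_mapsTube` produces.

HYPOTHESIS SHAPES (located, never asserted; in print's words).  (h26) `SiteGaugeInv γ (E X)` — (26) p. 263 *"for all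
gauge transformations 𝓊"* on the `G`-valued configurations (*"(26) holds for all regular gauge field configurations"*,
p. 264), `G` := the unitary group of the bond algebra (HONEST SCOPE (iii)), action (3.28).  (hE)+(hsp) holomorphy on
the `a`-tube — *"The third property is the analyticity with respect to U₁"* (p. 263) on the complex space (1.13).
(hloc) `(∀ b ∈ dep X, V b = V' b) → E X V = E X V'` — *"The second is a localization property … depends on U₁ restricted
to the set X̃⁵"* (p. 263).  (hfix) `∃ u` admissible, `∀ b ∈ dep X, (φᵘ) b = exp (gen X φ b)` — *"there exists a gauge
transformation in a neighbourhood of □₁ … such that the gauge transformed U₁ is represented as exp i𝓗(B) in the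
neighbourhood of □₁"* with *"X̃⁵ ⊂ □"* (p. 263, citing Sect. F of [7] = [Balaban1985Variational]); for complex
backgrounds cf. (1.12).  (hmaps) is NO LONGER a hypothesis on the tube model (§3); (hT) `sp' X ⊆ TubeCfg ι 𝔸 a₀` — the
space of (61)-pieces sits in the INNER tube (the located *"sufficiently small neighborhood"* of [I] p. 276, here a
produced number).

HONEST SCOPE.  (i) A MODEL DOMAIN: `MapsTube`, `gcInvariant_tube`, `exists_gcInvariant_tube` are theorems about the
lineage's tubes `TubeCfg` (bond variables `exp(B)·U` in one unital C⋆-algebra, a norm condition only).  Bałaban's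
spaces — B10's (17), [I]'s `Uᶜ_j(X, α₀, α₁)` with the conditions (1.11)–(1.14) (which include DERIVATIVE conditions
`|∇^ξA|`, `|∇^ξ_U A′|` and the block structure of (1.12)) — are not constructed, and whether the near-`G`
transformations map THOSE spaces into the analyticity domains (the «slot» question of cell GAPS G-B13-06a / G-adv7-7)
is NOT examined: on the tube model the proviso of [I] p. 276 is pure norm bookkeeping, and that is all §3 certifies.
(ii) (h26) = (26) for ALL unitary-valued site-dependent `u`, and the holomorphy (hE), are HYPOTHESES about print's
never-constructed `𝒫′₁`; print's support for (26) (invariance of (13), `dA` invariant under `A → R(𝓊)A`) is not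
examined, and the b13 caveat G-adv7-7 (the device support [13] (3.28)–(3.34) / [II] Lemma 2 read as delivering
invariance for block-constant `u`) is untouched — B10 itself states (26) for all gauge transformations of `U₁`.
(iii) THE SLICE IS `U(𝔸)`: `SiteGaugeInv` quantifies over unitary-valued `u` and `V` of the bond algebra; for `𝔸 =
M_N(ℂ)` this is the `G = U(N)` reading (transformations AND configurations), the lineage's `U(N)`-model of
`…B10Eq32SuN` / `…B10Eq26TubeIdentity` §5 — for print's `G = SU(N)` the binder must NOT be cited as (26) verbatim
(b13 XREAD C-B13-45 I-3); `SU(N)`-valued transformations on `SU(N)`-valued configurations with the `𝔰𝔩_N`-sub-tube are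
not typed (no consumer in the lineage; `…B10Eq26TubeIdentity` (T2) shows the `U(N)`-tube is not determined by the
`SU(N)`-slice).  (iv) MARGINS ARE NOT EXPLICIT: `δ(a)` comes from `map_exp_nhds_zero` (an open-mapping statement), then
`a₀ = c = min(1/3, δ/7)`; no identification with print's `α₀`, `α₁`, `ε`-neighbourhoods or with B10's (28) is claimed;
an explicit radius (e.g. `δ = 1 − e^{−a}` via the logarithm series) is not attempted.  (v) (29) IS CONDITIONAL ON A
DATUM: the gauge fixing `hfix` is located (p. 263, Sect. F of [7]) and never constructed; (27) (the definition of `B`)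
and (28) (its bound), `𝓗(B) = HB + A₁` and Eq. (158) of [7] are not typed — `gen X φ` ("i𝓗(B)", or "iη𝓗(B)" at scale
`k`, p. 271) and `dep X` ("X̃⁵") are abstract; for the complex tube the datum is asked with `u` in the `c`-tube (weaker
than unitary-valued), print performing the gauge fixing for the real configurations `U₁`, `U_{k+1}` (pp. 263, 271) and
stating (1.12) for the `U`-factor of a complex `𝐔 = U′U`.  (vi) FINITELY MANY bonds and sites (`[Fintype ι]`,
`[Fintype S]`) wherever the identity theorem or b13's near-orbit theorem is used; `a > 0` needed only where margins are
produced.  (vii) NO BOUND IS IMPROVED and no constant changes: §7 = gen 24's theorems with one binder generalized to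
print's wording and the conclusion moved along an equality; no (23)–(25), no (61)–(63) as printed (operator level is
`…B10LogDet63`), no Theorem 1 or 2, no convergence, no continuum statement; NOT summit progress, not Clay progress.
Cell GAPS: C-B13-44's `hmaps` is discharged for the TUBE MODEL DOMAIN ONLY; C-B13-32 moves, for the (J-b) reading,
from «(26) for the constant transformations on unitary-valued configurations + analyticity on the tube» to «(26) as
printed (all gauge transformations, site-dependent) on unitary-valued configurations + analyticity on the tube +
localization + the gauge-fixing datum, conclusion on `𝒫′₁(U₁) − 𝒫′₁(1)`» — all located, all still hypotheses about
print's `𝒫′₁`.  (viii) OWED, NOT DONE HERE (cell rule: no DOCFIX-only revisions): pv10 C-pv10-88 D1, adv2 C-adv2-75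
DOCFIX-1 and the C-b10g23-2 «SIBLING PRIOR ART» paragraph stay owed to `…B10Eq26MeasureInv`'s next substantive
revision; the parallel b13 leaf announced in CLAIMS.log l.53214 (hId-free restatements of `B13Inv214Orbit`'s own
theorems, `TubeChainConnected` via polar chains) is disjoint from this module, which restates none of b13's theorems
and touches neither `TubeChainConnected` nor `OrbitConstOn`.

SIBLING PRIOR ART (disclosed by name; cell GAPS C-b10g23-2 practice).  `…B10Eq61Leaves.tube_mem_nhds_of_mem_unitary` /
`tubeCfg_mem_nhds` (the tube is a neighbourhood of EACH unitary-valued point; pointwise, used there for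
differentiability) — §1's `exists_ball_one_subset_exp_image` + `mem_tube_of_norm_sub_lt` is the UNIFORM version the
margins need, proved from the same `map_exp_nhds_zero` (cited by name, not re-proved).
`…B10Eq61Leaves.norm_le_exp_of_mem_tube` (`‖V‖ ≤ e^{a}`, `[Nontrivial 𝔸]`, via `QuantumLattice.norm_exp_le`) — §1's
`norm_lt_exp_of_mem_tube` is strict and instance-free, via `ExpDuhamel.norm_exp_sub_one_le`; neither implies the other
as typed.  `…B10Eq31GlobalConj.conj_mem_tube` / `conj_mem_tubeCfg` (ONE unitary on both sides) is used by name inside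
`unitary_mul_mem_tube` (two different unitaries).  `…B13Inv214Orbit.differentiableAt_gaugeAct` is differentiability in
the TRANSFORMATION variable (`[Fintype S]`, at pointwise-invertible `u`); §2's `differentiable_gaugeAct_cfg` is in the
CONFIGURATION variable (linear, every `u`).  `Literature.Analysis.Calculus.SmoothAlongExp.localLog` (a local inverse
of `exp` at `0` over `ℝ`, inverse function theorem) is the same mechanism as `map_exp_nhds_zero`; not imported (real
scalars, `ContDiff` API), nothing of it is restated.  `lean search` (2026-08-19) for `MapsTube`, `SiteGaugeInv`,
"gauge transformation tube", "margin": no hit outside this lineage.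

RECORDS: cell GAPS C-b10g25-1 (this module), C-B13-44 UPDATE (b10-g25) (`hmaps` on the tube model), C-B13-32 UPDATE
(b10-g25); DIVERGENCE D-b10.30 (model margins `a₀ = c = min(1/3, δ(a)/7)` versus print's unquantified "sufficiently
small neighborhood"); no new bib key (keys used: Balaban1985UV3, Balaban1987RG1, Balaban1988RG2Cluster,
Balaban1985BackgroundPropagators, Balaban1985Variational — all in references.bib).
-/

open Metric Set Filter NormedSpace
open scoped Topology

namespace Literature.MathematicalPhysics.QuantumFieldTheory.Balaban1983to89.B10Eq26SiteGauge

open B10Eq29TubeLine (Tube TubeCfg expLine mem_tube mem_tubeCfg mem_tubeCfg_of_unitary mem_tube_of_mem_unitary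
  one_mem_tube exp_mul_mem_tube tube_mono expLine_zero)
open B13Inv214Orbit (Ends gaugeAct gaugeAct_eq_star gaugeAct_one gcInvariant_of_analyticOn
  nearOrbitConstOn_of_analyticOn NearOrbitConstOn inverse_eq_star_of_mem_unitary isUnit_of_mem_tube toyEnds
  toy_gaugeAct)
open B10Eq26TubeIdentity (tubeIdentity eqOn_tubeCfg_of_eqOn_unitary
  logHalfBound_expLine_of_unitaryClassFn logHalfBound_expLine_cplx_of_unitaryClassFn
  bound118_secondOrder_expLine_cplx_of_unitaryClassFn)
open B10Eq31GlobalConj (conj_mem_tube conj_mem_tubeCfg commSpan)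
open B10Eq61Leaves (map_exp_nhds_zero)
open B10Eq61PerSite (diffAlongV)

/-! ## §1. [folklore] Tube geometry: a UNIFORM neighbourhood of the unitaries inside the tube, and back -/

section TubeGeometry

variable {𝔸 : Type*} [CStarAlgebra 𝔸]

/-- A unitary has norm `≤ 1` (`= 1` unless `𝔸` is the zero algebra). [folklore] -/
theorem norm_le_one_of_mem_unitary {U : 𝔸} (hU : U ∈ unitary 𝔸) : ‖U‖ ≤ 1 := by
  rcases subsingleton_or_nontrivial 𝔸 with h | h
  · simp [Subsingleton.elim U 0]
  · exact (CStarRing.norm_of_mem_unitary hU).le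

/-- A point `exp B · U` of the tube lies within `e^{‖B‖} − 1` of the unitary `U` (the tree's [folklore]
`Literature.Analysis.Calculus.norm_exp_sub_one_le`, by name, the `ℚ`-algebra structure threaded by `letI`). [folklore] -/
theorem norm_exp_mul_sub_le (B : 𝔸) {U : 𝔸} (hU : U ∈ unitary 𝔸) :
    ‖exp B * U - U‖ ≤ Real.exp ‖B‖ - 1 := by
  letI : NormedAlgebra ℚ 𝔸 := NormedAlgebra.restrictScalars ℚ ℂ 𝔸
  have h : exp B * U - U = (exp B - 1) * U := by noncomm_ring
  rw [h, CStarRing.norm_mul_mem_unitary _ hU]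
  exact _root_.Literature.Analysis.Calculus.norm_exp_sub_one_le B

/-- The same on the other side: `‖U · exp B − U‖ ≤ e^{‖B‖} − 1`. [folklore] -/
theorem norm_mul_exp_sub_le (B : 𝔸) {U : 𝔸} (hU : U ∈ unitary 𝔸) :
    ‖U * exp B - U‖ ≤ Real.exp ‖B‖ - 1 := by
  letI : NormedAlgebra ℚ 𝔸 := NormedAlgebra.restrictScalars ℚ ℂ 𝔸
  have h : U * exp B - U = U * (exp B - 1) := by noncomm_ring
  rw [h, CStarRing.norm_mem_unitary_mul _ hU]
  exact _root_.Literature.Analysis.Calculus.norm_exp_sub_one_le B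

/-- `‖exp B · U‖ ≤ e^{‖B‖}` for `U` unitary (no `‖1‖ = 1` hypothesis: `‖1‖ ≤ 1` in every C⋆-algebra). [folklore] -/
theorem norm_exp_mul_le (B : 𝔸) {U : 𝔸} (hU : U ∈ unitary 𝔸) : ‖exp B * U‖ ≤ Real.exp ‖B‖ := by
  calc ‖exp B * U‖ = ‖(exp B * U - U) + U‖ := by rw [sub_add_cancel]
    _ ≤ ‖exp B * U - U‖ + ‖U‖ := norm_add_le _ _
    _ ≤ (Real.exp ‖B‖ - 1) + 1 := add_le_add (norm_exp_mul_sub_le B hU) (norm_le_one_of_mem_unitary hU)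
    _ = Real.exp ‖B‖ := by ring

/-- `‖U · exp B‖ ≤ e^{‖B‖}` for `U` unitary. [folklore] -/
theorem norm_mul_exp_le (B : 𝔸) {U : 𝔸} (hU : U ∈ unitary 𝔸) : ‖U * exp B‖ ≤ Real.exp ‖B‖ := by
  calc ‖U * exp B‖ = ‖(U * exp B - U) + U‖ := by rw [sub_add_cancel]
    _ ≤ ‖U * exp B - U‖ + ‖U‖ := norm_add_le _ _
    _ ≤ (Real.exp ‖B‖ - 1) + 1 := add_le_add (norm_mul_exp_sub_le B hU) (norm_le_one_of_mem_unitary hU)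
    _ = Real.exp ‖B‖ := by ring

/-- Points of the `a`-tube have norm `< e^{a}` (strict; no `[Nontrivial 𝔸]` — compare the sibling
`B10Eq61Leaves.norm_le_exp_of_mem_tube`). [folklore] -/
theorem norm_lt_exp_of_mem_tube {a : ℝ} {V : 𝔸} (hV : V ∈ Tube 𝔸 a) : ‖V‖ < Real.exp a := by
  obtain ⟨B, U, hB, hU, rfl⟩ := hV
  exact (norm_exp_mul_le B hU).trans_lt (Real.exp_lt_exp.2 hB)

/-- Every point of `Tube 𝔸 a₀` lies within `e^{a₀} − 1` of a unitary. [folklore] -/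
theorem exists_unitary_norm_sub_lt_of_mem_tube {a₀ : ℝ} {V : 𝔸} (hV : V ∈ Tube 𝔸 a₀) :
    ∃ U ∈ unitary 𝔸, ‖V - U‖ < Real.exp a₀ - 1 := by
  obtain ⟨B, U, hB, hU, rfl⟩ := hV
  exact ⟨U, hU, (norm_exp_mul_sub_le B hU).trans_lt (sub_lt_sub_right (Real.exp_lt_exp.2 hB) 1)⟩

/-- **A UNIFORM RADIUS**: for `a > 0` there is `δ > 0` with `ball 1 δ ⊆ exp(ball 0 a)` (`exp` is a local homeomorphism
at `0`: the tree's `B10Eq61Leaves.map_exp_nhds_zero`, by name). The radius is not made explicit (no Banach-algebra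
logarithm series is used). [folklore] -/
theorem exists_ball_one_subset_exp_image {a : ℝ} (ha : 0 < a) :
    ∃ δ > 0, ball (1 : 𝔸) δ ⊆ (exp : 𝔸 → 𝔸) '' ball 0 a := by
  have hN : (exp : 𝔸 → 𝔸) '' ball (0 : 𝔸) a ∈ 𝓝 (1 : 𝔸) := by
    rw [← map_exp_nhds_zero]
    exact image_mem_map (ball_mem_nhds 0 ha)
  exact Metric.mem_nhds_iff.mp hN

/-- **THE UNIFORM TUBE NEIGHBOURHOOD OF THE UNITARIES**: with `δ` as above, every `V` within `δ` of SOME unitary `U`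
lies in `Tube 𝔸 a` (`V·U⋆ ∈ ball 1 δ ⊆ exp(ball 0 a)`, so `V = exp(B)·U`). Uniformity in `U` is what the margins of §3
consume; the pointwise statement is the tree's `B10Eq61Leaves.tube_mem_nhds_of_mem_unitary`. [folklore] -/
theorem mem_tube_of_norm_sub_lt {a δ : ℝ} (hδ : ball (1 : 𝔸) δ ⊆ (exp : 𝔸 → 𝔸) '' ball 0 a) {U V : 𝔸}
    (hU : U ∈ unitary 𝔸) (hV : ‖V - U‖ < δ) : V ∈ Tube 𝔸 a := by
  have h1 : V * star U ∈ ball (1 : 𝔸) δ := by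
    rw [mem_ball, dist_eq_norm]
    have h : V * star U - 1 = (V - U) * star U := by
      rw [sub_mul, Unitary.mul_star_self_of_mem hU]
    rw [h, CStarRing.norm_mul_mem_unitary _ (Unitary.star_mem hU)]
    exact hV
  obtain ⟨B, hB, hBV⟩ := hδ h1
  refine ⟨B, U, by simpa using hB, hU, ?_⟩
  rw [hBV, mul_assoc, Unitary.star_mul_self_of_mem hU, mul_one]

end TubeGeometry

/-! ## §2. [folklore] The gauge action IN THE CONFIGURATION VARIABLE: linear in `V`; unitary-valued
## transformations preserve the unitary slice and the tube EXACTLY -/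

section CfgVariable

variable {ι S : Type*} {𝔸 : Type*} [CStarAlgebra 𝔸] (γ : Ends ι S)

/-- Right multiplication by a unitary preserves the tube: `exp(B)·U·w = exp(B)·(U·w)`. [folklore] -/
theorem mul_mem_tube_of_mem_unitary {a : ℝ} {V w : 𝔸} (hV : V ∈ Tube 𝔸 a) (hw : w ∈ unitary 𝔸) :
    V * w ∈ Tube 𝔸 a := by
  obtain ⟨B, U, hB, hU, rfl⟩ := hV
  exact ⟨B, U * w, hB, mul_mem hU hw, by rw [mul_assoc]⟩

/-- Two DIFFERENT unitaries on the two sides preserve the tube: `w₁·V·w₂⋆ = (w₁·V·w₁⋆)·(w₁·w₂⋆)` — conjugation (the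
tree's `B10Eq31GlobalConj.conj_mem_tube`) followed by a right unitary factor; the half-width is unchanged. [folklore] -/
theorem unitary_mul_mem_tube {a : ℝ} {V w₁ w₂ : 𝔸} (hV : V ∈ Tube 𝔸 a) (hw₁ : w₁ ∈ unitary 𝔸)
    (hw₂ : w₂ ∈ unitary 𝔸) : w₁ * V * star w₂ ∈ Tube 𝔸 a := by
  have h : w₁ * V * star w₂ = w₁ * V * star w₁ * (w₁ * star w₂) := by
    calc w₁ * V * star w₂ = w₁ * V * (star w₁ * w₁) * star w₂ := by
          rw [Unitary.star_mul_self_of_mem hw₁, mul_one]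
      _ = w₁ * V * star w₁ * (w₁ * star w₂) := by noncomm_ring
  rw [h]
  exact mul_mem_tube_of_mem_unitary (conj_mem_tube hV hw₁) (mul_mem hw₁ (Unitary.star_mem hw₂))

/-- **UNITARY-VALUED SITE-DEPENDENT TRANSFORMATIONS PRESERVE THE BONDWISE TUBE, with the same half-width** (the
action `(𝐕ᵘ)_b = u(b₋)·V_b·u(b₊)⁻¹` of [13] (3.28) p. 395, `B13Inv214Orbit.gaugeAct`). [folklore] -/
theorem gaugeAct_mem_tubeCfg_of_unitary {a : ℝ} {u : S → 𝔸} (hu : ∀ x, u x ∈ unitary 𝔸) {V : ι → 𝔸}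
    (hV : V ∈ TubeCfg ι 𝔸 a) : gaugeAct γ u V ∈ TubeCfg ι 𝔸 a := by
  rw [gaugeAct_eq_star γ hu]
  exact fun b => unitary_mul_mem_tube (hV b) (hu _) (hu _)

/-- Unitary-valued transformations preserve the unitary-valued (`G`-valued) configurations. [folklore] -/
theorem gaugeAct_unitary_of_unitary {u : S → 𝔸} (hu : ∀ x, u x ∈ unitary 𝔸) {V : ι → 𝔸}
    (hV : ∀ b, V b ∈ unitary 𝔸) : ∀ b, gaugeAct γ u V b ∈ unitary 𝔸 := by
  intro b
  rw [gaugeAct_eq_star γ hu]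
  exact mul_mem (mul_mem (hu _) (hV b)) (Unitary.star_mem (hu _))

/-- A CONSTANT unitary transformation `u ≡ W` acts by the global conjugation `V_b ↦ W·V_b·W⋆` of the lineage's
binder `h26` ([Balaban1985UV3] p. 264: *"The gauge invariance (26) implies the invariance with respect to the global
transformations R(U), U ∈ G"*). [cite: Balaban1985UV3, p.264 (sentence before (31))] -/
theorem gaugeAct_const {W : 𝔸} (hW : W ∈ unitary 𝔸) (V : ι → 𝔸) :
    gaugeAct γ (fun _ => W) V = fun b => W * V b * star W :=
  gaugeAct_eq_star γ (fun _ => hW) V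

variable [Fintype ι]

/-- The action is ℂ-LINEAR, hence ℂ-differentiable, in the configuration variable (for every fixed `u`, invertible or
not). [folklore] -/
theorem differentiable_gaugeAct_cfg (u : S → 𝔸) : Differentiable ℂ (gaugeAct γ u) := by
  refine differentiable_pi.mpr fun b => ?_
  show Differentiable ℂ fun V : ι → 𝔸 => u (γ.src b) * V b * Ring.inverse (u (γ.tgt b))
  exact ((differentiable_apply b).const_mul _).mul_const _

end CfgVariable

/-! ## §3. MARGINS: b13's located binder `hmaps` ([I] p. 276 «so that the configurations after the transformations
## belong to proper spaces also») DISCHARGED on the tube model -/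

section Margins

variable {ι S : Type*} {𝔸 : Type*} [CStarAlgebra 𝔸] (γ : Ends ι S)

variable (𝔸) in
/-- **THE MARGIN PROPERTY** `MapsTube 𝔸 γ a a₀ c`: every transformation in the `c`-tube maps every configuration of
the `a₀`-tube into the `a`-tube — `B13Inv214Orbit`'s binder `hmaps` for the domain `𝒟 = TubeCfg ι 𝔸 a` and the
space `𝒮 = TubeCfg ι 𝔸 a₀`, uniformly. [cite: Balaban1987RG1, p.276 (after (3.29)); Balaban1988RG2Cluster, p.21] -/
def MapsTube (a a₀ c : ℝ) : Prop :=
  ∀ u ∈ TubeCfg S 𝔸 c, ∀ V ∈ TubeCfg ι 𝔸 a₀, gaugeAct γ u V ∈ TubeCfg ι 𝔸 a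

/-- With margins, the smaller tube sits inside the larger one (`u ≡ 1`, which needs `c > 0`). [folklore] -/
theorem tubeCfg_subset_of_mapsTube {a a₀ c : ℝ} (hc : 0 < c) (hmaps : MapsTube 𝔸 γ a a₀ c) :
    TubeCfg ι 𝔸 a₀ ⊆ TubeCfg ι 𝔸 a := fun V hV => by
  have h := hmaps (fun _ => (1 : 𝔸)) (mem_tubeCfg_of_unitary hc fun _ => one_mem _) V hV
  rwa [gaugeAct_one] at h

/-- The inverse of a tube point `exp(C)·w` is `w⋆·exp(−C)`. [folklore] -/
theorem inverse_exp_mul_unitary (C : 𝔸) {w : 𝔸} (hw : w ∈ unitary 𝔸) :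
    Ring.inverse (exp C * w) = star w * exp (-C) := by
  letI : NormedAlgebra ℚ 𝔸 := NormedAlgebra.restrictScalars ℚ ℂ 𝔸
  have h1 : exp C * exp (-C) = 1 := by
    rw [← exp_add_of_commute (Commute.refl C).neg_right, add_neg_cancel, exp_zero]
  have h2 : exp (-C) * exp C = 1 := by
    rw [← exp_add_of_commute (Commute.refl C).neg_left, neg_add_cancel, exp_zero]
  have h3 : exp C * w * (star w * exp (-C)) = 1 := by
    calc exp C * w * (star w * exp (-C)) = exp C * (w * star w) * exp (-C) := by noncomm_ring
      _ = 1 := by rw [Unitary.mul_star_self_of_mem hw, mul_one, h1]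
  have h4 : star w * exp (-C) * (exp C * w) = 1 := by
    calc star w * exp (-C) * (exp C * w) = star w * (exp (-C) * exp C) * w := by noncomm_ring
      _ = 1 := by rw [h2, mul_one, Unitary.star_mul_self_of_mem hw]
  exact Ring.inverse_unit (⟨exp C * w, star w * exp (-C), h3, h4⟩ : 𝔸ˣ)

/-- **THE THREE-FACTOR ESTIMATE.** For a bond variable `exp(B)·U` of the `‖B‖`-tube and endpoint transformations
`exp(C₁)·w₁`, `exp(C₂)·w₂`, the transformed bond variable lies within `e^{‖C₁‖ + ‖B‖ + ‖C₂‖} − 1` of the UNITARY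
`w₁·U·w₂⋆` (`xyz − x₀y₀z₀ = (x − x₀)yz + x₀(y − y₀)z + x₀y₀(z − z₀)`; unitary factors cost nothing in a C⋆-norm).
[folklore] -/
theorem norm_gaugeBond_sub_le (C₁ C₂ B : 𝔸) {w₁ w₂ U : 𝔸} (hw₁ : w₁ ∈ unitary 𝔸) (hw₂ : w₂ ∈ unitary 𝔸)
    (hU : U ∈ unitary 𝔸) :
    ‖exp C₁ * w₁ * (exp B * U) * (star w₂ * exp (-C₂)) - w₁ * U * star w₂‖
      ≤ Real.exp (‖C₁‖ + ‖B‖ + ‖C₂‖) - 1 := by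
  have hw₂' : star w₂ ∈ unitary 𝔸 := Unitary.star_mem hw₂
  -- the algebra
  have hsplit : exp C₁ * w₁ * (exp B * U) * (star w₂ * exp (-C₂)) - w₁ * U * star w₂
      = (exp C₁ * w₁ - w₁) * (exp B * U) * (star w₂ * exp (-C₂))
        + w₁ * (exp B * U - U) * (star w₂ * exp (-C₂)) + w₁ * U * (star w₂ * exp (-C₂) - star w₂) := by
    noncomm_ring
  -- the seven norms
  have hx : ‖exp C₁ * w₁ - w₁‖ ≤ Real.exp ‖C₁‖ - 1 := norm_exp_mul_sub_le C₁ hw₁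
  have hy : ‖exp B * U‖ ≤ Real.exp ‖B‖ := norm_exp_mul_le B hU
  have hz : ‖star w₂ * exp (-C₂)‖ ≤ Real.exp ‖C₂‖ := by
    simpa only [norm_neg] using norm_mul_exp_le (-C₂) hw₂'
  have hx₀ : ‖w₁‖ ≤ 1 := norm_le_one_of_mem_unitary hw₁
  have hyy : ‖exp B * U - U‖ ≤ Real.exp ‖B‖ - 1 := norm_exp_mul_sub_le B hU
  have hy₀ : ‖U‖ ≤ 1 := norm_le_one_of_mem_unitary hU
  have hzz : ‖star w₂ * exp (-C₂) - star w₂‖ ≤ Real.exp ‖C₂‖ - 1 := by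
    simpa only [norm_neg] using norm_mul_exp_sub_le (-C₂) hw₂'
  have hE₁ : 0 ≤ Real.exp ‖C₁‖ - 1 := sub_nonneg.2 (Real.one_le_exp (norm_nonneg _))
  have hEB : 0 ≤ Real.exp ‖B‖ - 1 := sub_nonneg.2 (Real.one_le_exp (norm_nonneg _))
  have hEBp : 0 ≤ Real.exp ‖B‖ := (Real.exp_pos _).le
  -- the three products
  have h1 : ‖(exp C₁ * w₁ - w₁) * (exp B * U) * (star w₂ * exp (-C₂))‖
      ≤ (Real.exp ‖C₁‖ - 1) * Real.exp ‖B‖ * Real.exp ‖C₂‖ :=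
    norm_mul₃_le.trans (mul_le_mul (mul_le_mul hx hy (norm_nonneg _) hE₁) hz (norm_nonneg _)
      (mul_nonneg hE₁ hEBp))
  have h2 : ‖w₁ * (exp B * U - U) * (star w₂ * exp (-C₂))‖ ≤ 1 * (Real.exp ‖B‖ - 1) * Real.exp ‖C₂‖ :=
    norm_mul₃_le.trans (mul_le_mul (mul_le_mul hx₀ hyy (norm_nonneg _) zero_le_one) hz (norm_nonneg _)
      (mul_nonneg zero_le_one hEB))
  have h3 : ‖w₁ * U * (star w₂ * exp (-C₂) - star w₂)‖ ≤ 1 * 1 * (Real.exp ‖C₂‖ - 1) :=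
    norm_mul₃_le.trans (mul_le_mul (mul_le_mul hx₀ hy₀ (norm_nonneg _) zero_le_one) hzz (norm_nonneg _)
      (by norm_num))
  rw [hsplit]
  refine (norm_add₃_le).trans ((add_le_add (add_le_add h1 h2) h3).trans (le_of_eq ?_))
  rw [Real.exp_add, Real.exp_add]
  ring

/-- **MARGINS GIVE `hmaps`**: if `e^{c + a₀ + c} − 1 ≤ δ`, `δ` a uniform radius of §1 for the `a`-tube, then every
transformation of the `c`-tube maps the `a₀`-tube into the `a`-tube. [cite: Balaban1987RG1, p.276 (after (3.29)) («the constants in (3.29) are chosen in such a way that all the necessary restrictions on u, or u′, are satisfied, so that the configurations after the transformations belong to proper spaces also»)] -/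
theorem mapsTube_of_margin {a a₀ c δ : ℝ} (hδ : ball (1 : 𝔸) δ ⊆ (exp : 𝔸 → 𝔸) '' ball 0 a)
    (hm : Real.exp (c + a₀ + c) - 1 ≤ δ) : MapsTube 𝔸 γ a a₀ c := by
  intro u hu V hV b
  obtain ⟨C₁, w₁, hC₁, hw₁, h₁⟩ := hu (γ.src b)
  obtain ⟨C₂, w₂, hC₂, hw₂, h₂⟩ := hu (γ.tgt b)
  obtain ⟨B, U, hB, hU, hVb⟩ := hV b
  refine mem_tube_of_norm_sub_lt hδ (mul_mem (mul_mem hw₁ hU) (Unitary.star_mem hw₂)) ?_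
  show ‖u (γ.src b) * V b * Ring.inverse (u (γ.tgt b)) - w₁ * U * star w₂‖ < δ
  rw [h₁, h₂, hVb, inverse_exp_mul_unitary C₂ hw₂]
  refine (norm_gaugeBond_sub_le C₁ C₂ B hw₁ hw₂ hU).trans_lt (lt_of_lt_of_le ?_ hm)
  have hlt : ‖C₁‖ + ‖B‖ + ‖C₂‖ < c + a₀ + c := by linarith
  exact sub_lt_sub_right (Real.exp_lt_exp.2 hlt) 1

/-- **EXISTENCE OF MARGINS**: for every `a > 0` there are `a₀, c > 0` with `MapsTube 𝔸 γ a a₀ c` (take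
`a₀ = c = min(1/3, δ/7)`: then `e^{3a₀} − 1 ≤ 6a₀ < δ`, Mathlib `Real.abs_exp_sub_one_le`). [folklore] -/
theorem exists_mapsTube {a : ℝ} (ha : 0 < a) : ∃ a₀ > 0, ∃ c > 0, MapsTube 𝔸 γ a a₀ c := by
  obtain ⟨δ, hδ, hball⟩ := exists_ball_one_subset_exp_image (𝔸 := 𝔸) ha
  set s : ℝ := min (1 / 3) (δ / 7) with hs
  have hs0 : 0 < s := lt_min (by norm_num) (by linarith)
  have hs3 : s ≤ 1 / 3 := min_le_left _ _
  have hs7 : s ≤ δ / 7 := min_le_right _ _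
  refine ⟨s, hs0, s, hs0, mapsTube_of_margin γ hball ?_⟩
  have h3s : |3 * s| ≤ 1 := by
    rw [abs_of_nonneg (by linarith)]
    linarith
  have h := Real.abs_exp_sub_one_le h3s
  have h' : Real.exp (3 * s) - 1 ≤ 6 * s := by
    have h'' := (le_abs_self _).trans h
    rw [abs_of_nonneg (by linarith : (0 : ℝ) ≤ 3 * s)] at h''
    linarith
  calc Real.exp (s + s + s) - 1 = Real.exp (3 * s) - 1 := by rw [show s + s + s = 3 * s by ring]
    _ ≤ 6 * s := h'
    _ ≤ δ := by linarith

end Margins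

/-! ## §4. (26) FOR ALL (SITE-DEPENDENT, UNITARY-VALUED) GAUGE TRANSFORMATIONS, and its continuation in the
## configuration variable to the tube -/

section Eq26Site

variable {ι S : Type*} {𝔸 : Type*} [CStarAlgebra 𝔸] (γ : Ends ι S)

/-- **THE HYPOTHESIS SHAPE (26), SITE-DEPENDENT**: `F(𝐔ᵘ) = F(𝐔)` for ALL unitary-valued (`G`-valued) gauge
transformations `u` of the sites and all unitary-valued configurations `𝐔` — [Balaban1985UV3] p. 263 *"equalities hold
𝒫′₁(g₀, X, U₁ᵘ) = 𝒫′₁(g₀, X, U₁), (26) for all gauge transformations 𝓊"*, in the model (bond variables in a unital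
C⋆-algebra, `𝐔ᵘ_b = u(b₋)·U_b·u(b₊)⁻¹` = `B13Inv214Orbit.gaugeAct`). A HYPOTHESIS about print's `𝒫′₁`, never
discharged here. [cite: Balaban1985UV3, (26) p.263; Balaban1985BackgroundPropagators, (3.28) p.395] -/
def SiteGaugeInv (F : (ι → 𝔸) → ℂ) : Prop :=
  ∀ u : S → 𝔸, (∀ x, u x ∈ unitary 𝔸) → ∀ V : ι → 𝔸, (∀ b, V b ∈ unitary 𝔸) → F (gaugeAct γ u V) = F V

/-- Unfolding. [folklore] -/
theorem siteGaugeInv_iff (F : (ι → 𝔸) → ℂ) : SiteGaugeInv γ F ↔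
    ∀ u : S → 𝔸, (∀ x, u x ∈ unitary 𝔸) → ∀ V : ι → 𝔸, (∀ b, V b ∈ unitary 𝔸) → F (gaugeAct γ u V) = F V :=
  Iff.rfl

/-- **p. 264's SENTENCE AS A KERNEL TRIVIALITY**: (26) for all gauge transformations implies the invariance under the
GLOBAL transformations (constant `u ≡ W`) — exactly the lineage binder `h26` of `B10Eq26TubeIdentity` §3–§4.
[cite: Balaban1985UV3, p.264 («The gauge invariance (26) implies the invariance with respect to the global transformations R(U), U ∈ G»)] -/
theorem conjInv_of_siteGaugeInv {F : (ι → 𝔸) → ℂ} (h26 : SiteGaugeInv γ F) :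
    ∀ W ∈ unitary 𝔸, ∀ V : ι → 𝔸, (∀ b, V b ∈ unitary 𝔸) → F (fun b => W * V b * star W) = F V := by
  intro W hW V hV
  rw [← gaugeAct_const γ hW V]
  exact h26 (fun _ => W) (fun _ => hW) V hV

variable [Fintype ι]

/-- **(26) CONTINUED IN THE CONFIGURATION VARIABLE**: for each unitary-valued `u`, a function holomorphic on the
tube (*"The third property is the analyticity with respect to U₁"*) and (26)-invariant on the unitary-valued
configurations is `u`-invariant on the WHOLE tube (`V ↦ 𝐕ᵘ` is linear and preserves the tube, §2; the slice identity
theorem `B10Eq26TubeIdentity.tubeIdentity`). [cite: Balaban1985UV3, (26) p.263, p.263 («third property»), p.264 («(26) holds for all regular gauge field configurations»)] -/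
theorem siteGaugeInv_tube {a : ℝ} {F : (ι → 𝔸) → ℂ} (hF : DifferentiableOn ℂ F (TubeCfg ι 𝔸 a))
    (h26 : SiteGaugeInv γ F) {u : S → 𝔸} (hu : ∀ x, u x ∈ unitary 𝔸) :
    ∀ V ∈ TubeCfg ι 𝔸 a, F (gaugeAct γ u V) = F V :=
  eqOn_tubeCfg_of_eqOn_unitary
    (hF.comp (differentiable_gaugeAct_cfg γ u).differentiableOn fun _ hV =>
      gaugeAct_mem_tubeCfg_of_unitary γ hu hV)
    hF fun V hV => h26 u hu V hV

end Eq26Site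

/-! ## §5. THE JOIN: [I] (1.19)-shape invariance NEAR `G` on the tube model from (26) + holomorphy ALONE
## (b13's `hId` AND `hmaps` discharged) -/

section Join

variable {ι S : Type*} [Fintype ι] [Fintype S] {𝔸 : Type*} [CStarAlgebra 𝔸] (γ : Ends ι S)

/-- **`Gᶜ`-VALUED TRANSFORMATIONS NEAR `G`, CONFIGURATIONS IN THE TUBE.** With margins `MapsTube 𝔸 γ a a₀ c`
(§3, `c > 0`): a function holomorphic on the `a`-tube and satisfying (26) for all unitary-valued gauge transformations
on the unitary-valued configurations is invariant under every transformation of the `c`-tube at every configuration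
of the `a₀`-tube — `B13Inv214Orbit.gcInvariant_of_analyticOn` with (H6) := `tubeIdentity c`, `hmaps` := the margins,
and (R1) on the tube := §4. [cite: Balaban1987RG1, (1.19) p.263, p.283 («implied by the invariance with respect to G-valued transformations, and by the analyticity»); Balaban1988RG2Cluster, p.21; Balaban1985UV3, (26) p.263] -/
theorem gcInvariant_tube {a a₀ c : ℝ} (hc : 0 < c) (hmaps : MapsTube 𝔸 γ a a₀ c) {F : (ι → 𝔸) → ℂ}
    (hF : DifferentiableOn ℂ F (TubeCfg ι 𝔸 a)) (h26 : SiteGaugeInv γ F) :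
    ∀ u ∈ TubeCfg S 𝔸 c, ∀ V ∈ TubeCfg ι 𝔸 a₀, F (gaugeAct γ u V) = F V := by
  intro u hu V hV
  exact gcInvariant_of_analyticOn γ (tubeIdentity c) hF (fun u' hu' => hmaps u' hu' V hV)
    (fun u' hu' => siteGaugeInv_tube γ hF h26 hu' V (tubeCfg_subset_of_mapsTube γ hc hmaps hV)) u hu

/-- **THE HYPOTHESIS-FREE PACKAGING**: for every `a > 0` there are `a₀, c > 0` such that EVERY function holomorphic
on the `a`-tube with (26) for all unitary-valued gauge transformations is invariant under the `c`-tube-valued ones on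
the `a₀`-tube — the printed *"in a small neighborhood of the space of G-valued ones"* with the neighbourhoods
produced, not assumed. [cite: Balaban1988RG2Cluster, p.21; Balaban1987RG1, p.283] -/
theorem exists_gcInvariant_tube {a : ℝ} (ha : 0 < a) :
    ∃ a₀ > 0, ∃ c > 0, ∀ F : (ι → 𝔸) → ℂ, DifferentiableOn ℂ F (TubeCfg ι 𝔸 a) → SiteGaugeInv γ F →
      ∀ u ∈ TubeCfg S 𝔸 c, ∀ V ∈ TubeCfg ι 𝔸 a₀, F (gaugeAct γ u V) = F V := by
  obtain ⟨a₀, ha₀, c, hc, hmaps⟩ := exists_mapsTube (𝔸 := 𝔸) γ ha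
  exact ⟨a₀, ha₀, c, hc, fun F hF h26 => gcInvariant_tube γ hc hmaps hF h26⟩

/-- b13's (R3)-input `NearOrbitConstOn` ON THE TUBE MODEL SPACE `𝒮 = TubeCfg ι 𝔸 a₀`, with all of its located
binders except (26) and holomorphy discharged. [cite: Balaban1988RG2Cluster, pp.21–22] -/
theorem nearOrbitConstOn_tube {a a₀ c : ℝ} (hc : 0 < c) (hmaps : MapsTube 𝔸 γ a a₀ c) {F : (ι → 𝔸) → ℂ}
    (hF : DifferentiableOn ℂ F (TubeCfg ι 𝔸 a)) (h26 : SiteGaugeInv γ F) :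
    NearOrbitConstOn γ c F (TubeCfg ι 𝔸 a₀) :=
  nearOrbitConstOn_of_analyticOn γ (tubeIdentity c) hF (fun V hV u hu => hmaps u hu V hV)
    fun V hV _u hu => siteGaugeInv_tube γ hF h26 hu V (tubeCfg_subset_of_mapsTube γ hc hmaps hV)

end Join

/-! ## §6. (29) TYPED: (26) + the localization property + the gauge-fixing DATUM of p. 263 give
## `𝒫′₁(g₀, X, U₁) = 𝒫′₁(g₀, X, exp i𝓗(B))`; the lineage's model difference IS the printed (61)-difference -/

section Eq29

variable {ι S : Type*} {𝔸 : Type*} [CStarAlgebra 𝔸] (γ : Ends ι S) {D : LocDomainSys}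
  {sp' sp : D.Dom → Set (ι → 𝔸)} {E : D.Dom → (ι → 𝔸) → ℂ} {gen : D.Dom → (ι → 𝔸) → ι → 𝔸}
  {dep : D.Dom → Set ι} {nX : D.Dom → ℕ}

/-- The exponential line with base point `1` at `ζ = 1` is the configuration `exp(gen X φ)` ("`exp i𝓗(B)`").
[cite: Balaban1985UV3, (29) p.263] -/
theorem expLine_one_one (X : D.Dom) (φ : ι → 𝔸) :
    expLine gen (fun _ _ _ => 1) X φ 1 = fun b => exp (gen X φ b) := by
  funext b
  simp [expLine]

/-- **(29) FROM (26), LOCALIZATION AND A GAUGE FIXING** — abstract admissible class `P X` of transformations: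
if `E X` is invariant under the admissible transformations at the points of `sp' X` (`hinv`), depends on the
configuration only through the bonds of `dep X` (`hloc`: *"The expression 𝒫′₁(g₀, X, U₁) depends on U₁ restricted
to the set X̃⁵"*), and every `φ ∈ sp' X` is gauged by an admissible transformation to `exp(gen X φ)` on `dep X`
(`hfix`: *"there exists a gauge transformation in a neighbourhood of □₁ … such that the gauge transformed U₁ is
represented as exp i𝓗(B) in the neighbourhood of □₁"*, with *"X̃⁵ ⊂ □"*), then `E X φ = E X (exp(gen X φ))` —
*"By the gauge invariance (26), we have 𝒫′₁(g₀, X, U₁) = 𝒫′₁(g₀, X, exp i𝓗(B)), (29)"*. The gauge fixing is a DATUM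
(hypothesis), not constructed. [cite: Balaban1985UV3, (26) p.263, p.263 (localization property; gauge fixing before (27)), (29) p.263] -/
theorem eq29_of_gaugeFix {P : D.Dom → (S → 𝔸) → Prop}
    (hloc : ∀ X (V V' : ι → 𝔸), (∀ b ∈ dep X, V b = V' b) → E X V = E X V')
    (hinv : ∀ X φ, φ ∈ sp' X → ∀ u, P X u → E X (gaugeAct γ u φ) = E X φ)
    (hfix : ∀ X φ, φ ∈ sp' X → ∃ u, P X u ∧ ∀ b ∈ dep X, gaugeAct γ u φ b = exp (gen X φ b)) :
    ∀ X φ, φ ∈ sp' X → E X φ = E X (expLine gen (fun _ _ _ => 1) X φ 1) := by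
  intro X φ hφ
  obtain ⟨u, hu, hfixu⟩ := hfix X φ hφ
  rw [← hinv X φ hφ u hu, expLine_one_one]
  exact hloc X _ _ fun b hb => hfixu b hb

/-- **(29), REAL (unitary-valued) CONFIGURATIONS**: admissible = unitary-valued transformations; the invariance is
(26) itself. [cite: Balaban1985UV3, (26) p.263, (29) p.263] -/
theorem eq29_of_unitaryGaugeFix
    (hloc : ∀ X (V V' : ι → 𝔸), (∀ b ∈ dep X, V b = V' b) → E X V = E X V')
    (h26 : ∀ X, SiteGaugeInv γ (E X)) (hU : ∀ X φ, φ ∈ sp' X → ∀ b, φ b ∈ unitary 𝔸)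
    (hfix : ∀ X φ, φ ∈ sp' X → ∃ u : S → 𝔸, (∀ x, u x ∈ unitary 𝔸) ∧
      ∀ b ∈ dep X, gaugeAct γ u φ b = exp (gen X φ b)) :
    ∀ X φ, φ ∈ sp' X → E X φ = E X (expLine gen (fun _ _ _ => 1) X φ 1) :=
  eq29_of_gaugeFix γ (P := fun _ u => ∀ x, u x ∈ unitary 𝔸) hloc
    (fun X φ hφ u hu => h26 X u hu φ (hU X φ hφ)) hfix

/-- A unitary-valued gauge-fixing datum is a tube-valued one, for every `c > 0` (unitaries lie in every tube).
[folklore] -/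
theorem tubeGaugeFix_of_unitaryGaugeFix {c : ℝ} (hc : 0 < c)
    (hfix : ∀ X φ, φ ∈ sp' X → ∃ u : S → 𝔸, (∀ x, u x ∈ unitary 𝔸) ∧
      ∀ b ∈ dep X, gaugeAct γ u φ b = exp (gen X φ b)) :
    ∀ X φ, φ ∈ sp' X → ∃ u ∈ TubeCfg S 𝔸 c, ∀ b ∈ dep X, gaugeAct γ u φ b = exp (gen X φ b) := by
  intro X φ hφ
  obtain ⟨u, hu, h⟩ := hfix X φ hφ
  exact ⟨u, mem_tubeCfg_of_unitary hc hu, h⟩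

/-- **(29), COMPLEX (tube-valued) CONFIGURATIONS**: admissible = transformations of the `c`-tube (`Gᶜ`-valued near
`G`); the invariance is §5's join (margins `MapsTube 𝔸 γ a a₀ c`, holomorphy on the `a`-tube, `sp' X` inside the
`a₀`-tube). [cite: Balaban1985UV3, (26) p.263, (29) p.263; Balaban1987RG1, (1.19) p.263, p.283] -/
theorem eq29_of_tubeGaugeFix [Fintype ι] [Fintype S] {a a₀ c : ℝ} (hc : 0 < c) (hmaps : MapsTube 𝔸 γ a a₀ c)
    (hsp : ∀ X, TubeCfg ι 𝔸 a ⊆ sp X) (hE : ∀ X, DifferentiableOn ℂ (E X) (sp X))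
    (hloc : ∀ X (V V' : ι → 𝔸), (∀ b ∈ dep X, V b = V' b) → E X V = E X V')
    (h26 : ∀ X, SiteGaugeInv γ (E X)) (hT : ∀ X, sp' X ⊆ TubeCfg ι 𝔸 a₀)
    (hfix : ∀ X φ, φ ∈ sp' X → ∃ u ∈ TubeCfg S 𝔸 c, ∀ b ∈ dep X, gaugeAct γ u φ b = exp (gen X φ b)) :
    ∀ X φ, φ ∈ sp' X → E X φ = E X (expLine gen (fun _ _ _ => 1) X φ 1) :=
  eq29_of_gaugeFix γ (P := fun _ u => u ∈ TubeCfg S 𝔸 c) hloc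
    (fun X φ hφ u hu => gcInvariant_tube γ hc hmaps ((hE X).mono (hsp X)) (h26 X) u hu φ (hT X hφ))
    fun X φ hφ => by
      obtain ⟨u, hu, h⟩ := hfix X φ hφ
      exact ⟨u, hu, h⟩

/-- **THE MODEL DIFFERENCE IS THE PRINTED (61)-DIFFERENCE**: under (29), the lineage's `diffAlongV E (expLine gen 1)`
(value at `ζ = 1` minus value at `ζ = 0` of the line) equals `E X φ − E X 1` on `sp' X` — [Balaban1985UV3] p. 271
*"representation U_{k+1} = exp iη𝓗(B) (modulo a gauge transformation) in a neighbourhood of □₁"*, (61).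
[cite: Balaban1985UV3, (29) p.263, (61) p.271] -/
theorem diffAlongV_eq_sub (h29 : ∀ X φ, φ ∈ sp' X → E X φ = E X (expLine gen (fun _ _ _ => 1) X φ 1)) :
    ∀ X φ, φ ∈ sp' X → diffAlongV E (expLine gen (fun _ _ _ => 1)) X φ = E X φ - E X (fun _ => 1) := by
  intro X φ hφ
  show E X (expLine gen (fun _ _ _ => 1) X φ 1) - E X (expLine gen (fun _ _ _ => 1) X φ 0) = _
  rw [← h29 X φ hφ, expLine_zero]

omit [CStarAlgebra 𝔸] in
/-- Transfer of a `LogHalfBound` along a pointwise identity on the spaces. [folklore] -/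
theorem logHalfBound_congr {E₁ E₂ : D.Dom → (ι → 𝔸) → ℂ} {B r : ℝ}
    (h : ∀ X φ, φ ∈ sp' X → E₁ X φ = E₂ X φ) (h₁ : B13.LogHalfBound D sp' E₁ nX B r) :
    B13.LogHalfBound D sp' E₂ nX B r := by
  intro X φ hφ
  rw [← h X φ hφ]
  exact h₁ X φ hφ

omit [CStarAlgebra 𝔸] in
/-- Transfer of a `Bound118` along a pointwise identity on the spaces. [folklore] -/
theorem bound118_congr {E₁ E₂ : D.Dom → (ι → 𝔸) → ℂ} {E₀ κ : ℝ}
    (h : ∀ X φ, φ ∈ sp' X → E₁ X φ = E₂ X φ) (h₁ : B13.Bound118 D sp' E₁ E₀ κ) :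
    B13.Bound118 D sp' E₂ E₀ κ := by
  intro X φ hφ
  rw [← h X φ hφ]
  exact h₁ X φ hφ

end Eq29

/-! ## §7. THE LINEAGE'S JOINT THEOREMS RESTATED ON THE PRINTED DIFFERENCE `E X φ − E X 1` from (26) for all gauge
## transformations (site-dependent) + holomorphy + localization + the gauge-fixing datum -/

section Joint

variable {ι S : Type*} [Fintype ι] {𝔸 : Type*} [CStarAlgebra 𝔸] (γ : Ends ι S) {D : LocDomainSys}
  {sp' sp : D.Dom → Set (ι → 𝔸)} {E : D.Dom → (ι → 𝔸) → ℂ} {gen : D.Dom → (ι → 𝔸) → ι → 𝔸}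
  {dep : D.Dom → Set ι} {nX : D.Dom → ℕ}

/-- **REAL BACKGROUND** — `B10Eq26TubeIdentity.logHalfBound_expLine_of_unitaryClassFn` with its constant-`W`
binder `h26` supplied by (26) for all gauge transformations (§4) and its conclusion transported to the printed
difference `𝒫′₁(g₀, X, U₁) − 𝒫′₁(g₀, X, 1)` by (29) (§6: localization `hloc`, unitary-valued configurations `hU`,
gauge-fixing datum `hfix`). Constant `8((p + q)/a)²·B`, rate `r − 2`.
[cite: Balaban1985UV3, (26) p.263 + p.263 (localization, analyticity, gauge fixing), (29) p.263, (31)–(32) p.264, (61) p.271] -/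
theorem logHalfBound_sub_of_siteGaugeInv {B r a p q : ℝ} (ha : 0 < a) (hp : 0 ≤ p) (hq : 0 ≤ q)
    (hpq : 0 < p + q) (hB : 0 ≤ B) (hgen : ∀ X φ, φ ∈ sp' X → ∀ b, gen X φ b ∈ skewAdjoint 𝔸)
    (hbound : ∀ X φ, φ ∈ sp' X → ∀ b, ‖gen X φ b‖ ≤ p + q * (1 + D.dj X))
    (hsp : ∀ X, TubeCfg ι 𝔸 a ⊆ sp X) (hE : ∀ X, DifferentiableOn ℂ (E X) (sp X))
    (h26 : ∀ X, SiteGaugeInv γ (E X))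
    (hcomm : ∀ X φ, φ ∈ sp' X → ∀ b, gen X φ b ∈ closure (commSpan 𝔸 : Set 𝔸))
    (hEb : B13.LogHalfBound D sp E nX B r)
    (hloc : ∀ X (V V' : ι → 𝔸), (∀ b ∈ dep X, V b = V' b) → E X V = E X V')
    (hU : ∀ X φ, φ ∈ sp' X → ∀ b, φ b ∈ unitary 𝔸)
    (hfix : ∀ X φ, φ ∈ sp' X → ∃ u : S → 𝔸, (∀ x, u x ∈ unitary 𝔸) ∧
      ∀ b ∈ dep X, gaugeAct γ u φ b = exp (gen X φ b)) :
    B13.LogHalfBound D sp' (fun X φ => E X φ - E X (fun _ => 1)) nX (8 * ((p + q) / a) ^ 2 * B) (r - 2) :=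
  logHalfBound_congr (diffAlongV_eq_sub (eq29_of_unitaryGaugeFix γ hloc h26 hU hfix))
    (logHalfBound_expLine_of_unitaryClassFn ha hp hq hpq hB hgen hbound hsp hE
      (fun X => conjInv_of_siteGaugeInv γ (h26 X)) hcomm hEb)

variable [Fintype S]

/-- **COMPLEX BACKGROUND** — `B10Eq26TubeIdentity.logHalfBound_expLine_cplx_of_unitaryClassFn` with `h26` from
(26) for all gauge transformations and the conclusion transported to `E X φ − E X 1` by the complex (29) (§6:
margins `MapsTube 𝔸 γ a a₀ c`, `sp' X` inside the `a₀`-tube, tube-valued gauge-fixing datum). Constant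
`8·((2p + q)/(min(1/8, a/2) − p))²·B`, rate `r − 2`.
[cite: Balaban1985UV3, (26) p.263 + p.263 (localization, analyticity, gauge fixing), (29) p.263, (31)–(32) p.264, (61) p.271; Balaban1987RG1, (1.13) p.262, (1.19) p.263, p.276, p.283; Balaban1988RG2Cluster, p.21] -/
theorem logHalfBound_sub_cplx_of_siteGaugeInv {B r a p q a₀ c : ℝ} (hp : 0 ≤ p) (hq : 0 ≤ q)
    (hpq : 0 < p + q) (hpa : p < min (1 / 8) (a / 2)) (hB : 0 ≤ B)
    (hsplit : ∀ X φ, φ ∈ sp' X → ∀ b, ∃ T ∈ skewAdjoint 𝔸,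
      ‖T‖ ≤ q * (1 + D.dj X) ∧ ‖gen X φ b - T‖ ≤ p)
    (hsp : ∀ X, TubeCfg ι 𝔸 a ⊆ sp X) (hE : ∀ X, DifferentiableOn ℂ (E X) (sp X))
    (h26 : ∀ X, SiteGaugeInv γ (E X))
    (hcomm : ∀ X φ, φ ∈ sp' X → ∀ b, gen X φ b ∈ closure (commSpan 𝔸 : Set 𝔸))
    (hEb : B13.LogHalfBound D sp E nX B r)
    (hloc : ∀ X (V V' : ι → 𝔸), (∀ b ∈ dep X, V b = V' b) → E X V = E X V')
    (hc : 0 < c) (hmaps : MapsTube 𝔸 γ a a₀ c) (hT : ∀ X, sp' X ⊆ TubeCfg ι 𝔸 a₀)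
    (hfix : ∀ X φ, φ ∈ sp' X → ∃ u ∈ TubeCfg S 𝔸 c, ∀ b ∈ dep X, gaugeAct γ u φ b = exp (gen X φ b)) :
    B13.LogHalfBound D sp' (fun X φ => E X φ - E X (fun _ => 1)) nX
      (8 * ((2 * p + q) / (min (1 / 8) (a / 2) - p)) ^ 2 * B) (r - 2) :=
  logHalfBound_congr (diffAlongV_eq_sub (eq29_of_tubeGaugeFix γ hc hmaps hsp hE hloc h26 hT hfix))
    (logHalfBound_expLine_cplx_of_unitaryClassFn hp hq hpq hpa hB hsplit hsp hE
      (fun X => conjInv_of_siteGaugeInv γ (h26 X)) hcomm hEb)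

/-- **(I.1.18) FOR THE (61)-PIECES ALONG COMPLEX BACKGROUNDS ON THE PRINTED DIFFERENCE** —
`B10Eq26TubeIdentity.bound118_secondOrder_expLine_cplx_of_unitaryClassFn` with `h26` from (26) for all gauge
transformations and the conclusion transported to `E X φ − E X 1`. Constant `(64A(1 + c₀²)/(min(1/8, a/2) − α₁)²)·c₁`,
rate `r − 3`.
[cite: Balaban1988RG2Cluster, pp.15, 20–21; Balaban1985UV3, (26) p.263 + p.263 (localization, analyticity, gauge fixing), (29), (31)–(32) pp.263–264, (61) p.271; Balaban1987RG1, (1.12)–(1.13) p.262, (1.19) p.263, p.276, p.283] -/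
theorem bound118_sub_cplx_of_siteGaugeInv (K : B13.Consts) (h21 : K.R21)
    (hLM : 1 ≤ (K.L : ℝ) * K.M) (hα₀ : 0 ≤ K.α₀) (hα₁ : 0 < K.α₁) {A a c₀ r c₁ a₀ c : ℝ} (hA : 0 ≤ A)
    (hc₀ : 0 ≤ c₀) (hα₁a : K.α₁ < min (1 / 8) (a / 2))
    (hsplit : ∀ X φ, φ ∈ sp' X → ∀ b, ∃ T ∈ skewAdjoint 𝔸,
      ‖T‖ ≤ c₀ * ((K.L : ℝ) * K.M) * K.α₀ * (1 + D.dj X) ∧ ‖gen X φ b - T‖ ≤ K.α₁)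
    (hsp : ∀ X, TubeCfg ι 𝔸 a ⊆ sp X) (hE : ∀ X, DifferentiableOn ℂ (E X) (sp X))
    (h26 : ∀ X, SiteGaugeInv γ (E X))
    (hcomm : ∀ X φ, φ ∈ sp' X → ∀ b, gen X φ b ∈ closure (commSpan 𝔸 : Set 𝔸))
    (hEb : B13.LogHalfBound D sp E nX (A * ((K.L : ℝ) * K.M) ^ 4) r) (hvol : B13.VolBoundK1 D nX c₁)
    (hc₁ : 0 ≤ c₁)
    (hloc : ∀ X (V V' : ι → 𝔸), (∀ b ∈ dep X, V b = V' b) → E X V = E X V')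
    (hc : 0 < c) (hmaps : MapsTube 𝔸 γ a a₀ c) (hT : ∀ X, sp' X ⊆ TubeCfg ι 𝔸 a₀)
    (hfix : ∀ X φ, φ ∈ sp' X → ∃ u ∈ TubeCfg S 𝔸 c, ∀ b ∈ dep X, gaugeAct γ u φ b = exp (gen X φ b)) :
    B13.Bound118 D sp' (fun X φ => E X φ - E X (fun _ => 1))
      (64 * A * (1 + c₀ ^ 2) / (min (1 / 8) (a / 2) - K.α₁) ^ 2 * c₁) (r - 3) :=
  bound118_congr (diffAlongV_eq_sub (eq29_of_tubeGaugeFix γ hc hmaps hsp hE hloc h26 hT hfix))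
    (bound118_secondOrder_expLine_cplx_of_unitaryClassFn K h21 hLM hα₀ hα₁ hA hc₀ hα₁a hsplit hsp hE
      (fun X => conjInv_of_siteGaugeInv γ (h26 X)) hcomm hEb hvol hc₁)

end Joint

/-! ## §8. Non-vacuity -/

section Toys

/-- **THE MARGINS ARE NECESSARY** (`𝔸 = ℂ`, one bond from site `true` to site `false`): the transformation
`u = (e^{a/2} at true, e^{−a/2} at false)` lies in the `a`-tube, yet it maps the configuration `V ≡ 1` (in every
`a₀`-tube) to `e^{a} ∉ Tube ℂ a` — so `MapsTube ℂ toyEnds a a₀ a` FAILS for every `a₀ > 0`: the transformation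
tube must be strictly thinner than the target tube. [folklore] -/
theorem toy_not_mapsTube {a a₀ : ℝ} (ha : 0 < a) (ha₀ : 0 < a₀) : ¬ MapsTube ℂ toyEnds a a₀ a := by
  intro h
  set u : Bool → ℂ := fun x => bif x then (Real.exp (a / 2) : ℂ) else (Real.exp (-(a / 2)) : ℂ) with hu_def
  have hu : u ∈ TubeCfg Bool ℂ a := by
    intro x
    cases x
    · refine ⟨((-(a / 2) : ℝ) : ℂ), 1, ?_, one_mem _, ?_⟩
      · rw [Complex.norm_real, Real.norm_eq_abs, abs_neg, abs_of_pos (by positivity)]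
        linarith
      · simp only [hu_def, Bool.cond_false, mul_one, Complex.ofReal_exp, Complex.exp_eq_exp_ℂ]
    · refine ⟨((a / 2 : ℝ) : ℂ), 1, ?_, one_mem _, ?_⟩
      · rw [Complex.norm_real, Real.norm_eq_abs, abs_of_pos (by positivity)]
        linarith
      · simp only [hu_def, Bool.cond_true, mul_one, Complex.ofReal_exp, Complex.exp_eq_exp_ℂ]
  have hV : (fun _ : Unit => (1 : ℂ)) ∈ TubeCfg Unit ℂ a₀ := mem_tubeCfg_of_unitary ha₀ fun _ => one_mem _
  have hmem := h u hu (fun _ => 1) hV ()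
  have hval : gaugeAct toyEnds u (fun _ => 1) () = (Real.exp a : ℂ) := by
    rw [toy_gaugeAct]
    simp only [hu_def, Bool.cond_true, Bool.cond_false, mul_one]
    rw [← Complex.ofReal_inv, ← Complex.ofReal_mul, ← Real.exp_neg, neg_neg, ← Real.exp_add]
    norm_num
  have hlt := norm_lt_exp_of_mem_tube hmem
  rw [hval, Complex.norm_real, Real.norm_eq_abs, abs_of_pos (Real.exp_pos a)] at hlt
  exact lt_irrefl _ hlt

/-- But margins DO exist for the toy (an instance of `exists_mapsTube`). [folklore] -/
example {a : ℝ} (ha : 0 < a) : ∃ a₀ > 0, ∃ c > 0, MapsTube ℂ toyEnds a a₀ c := exists_mapsTube toyEnds ha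

/-- **THE AXIAL TOY FOR (29)** (one bond `b` from site `true` to site `false`, any unital C⋆-algebra): every unitary
configuration is gauged to `1 = exp 0` by `u(true) = 1`, `u(false) = V_b` — so the gauge-fixing datum `hfix` of §6
holds with generator `0` and `dep = univ`, and (29) says that a (26)-invariant localized `E` takes at every unitary
configuration its value at the configuration `1` (pure gauge on a tree). [folklore] -/
theorem toy_axial_gaugeFix {𝔸 : Type*} [CStarAlgebra 𝔸] (V : Unit → 𝔸) (hV : ∀ b, V b ∈ unitary 𝔸) :
    ∃ u : Bool → 𝔸, (∀ x, u x ∈ unitary 𝔸) ∧ ∀ b ∈ (univ : Set Unit), gaugeAct toyEnds u V b = exp (0 : 𝔸) := by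
  refine ⟨fun x => bif x then 1 else V (), fun x => by cases x <;> simp [hV ()], fun b _ => ?_⟩
  rw [gaugeAct_eq_star toyEnds (fun x => by cases x <;> simp [hV ()])]
  simp only [toyEnds, Bool.cond_true, Bool.cond_false, one_mul, exp_zero]
  exact Unitary.mul_star_self_of_mem (hV ())

/-- **THE SAME DATUM ON THE COMPLEX TUBE**: a one-bond configuration of the `c`-tube (`c > 0`) is gauged to
`1 = exp 0` by the transformation `u(true) = 1, u(false) = V_b`, which lies in the SAME `c`-tube — so the tube-valued
gauge-fixing datum of `eq29_of_tubeGaugeFix` is satisfiable with `a₀ = c` (the shape `exists_mapsTube` produces).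
[folklore] -/
theorem toy_axial_tubeGaugeFix {𝔸 : Type*} [CStarAlgebra 𝔸] {c : ℝ} (hc : 0 < c) (V : Unit → 𝔸)
    (hV : V ∈ TubeCfg Unit 𝔸 c) :
    ∃ u ∈ TubeCfg Bool 𝔸 c, ∀ b ∈ (univ : Set Unit), gaugeAct toyEnds u V b = exp (0 : 𝔸) := by
  refine ⟨fun x => bif x then 1 else V (), fun x => ?_, fun b _ => ?_⟩
  · cases x
    · exact hV ()
    · exact one_mem_tube hc
  · have hu : IsUnit (V ()) := isUnit_of_mem_tube (hV ())
    show (bif true then (1 : 𝔸) else V ()) * V b * Ring.inverse (bif false then (1 : 𝔸) else V ()) = exp (0 : 𝔸)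
    simp only [Bool.cond_true, Bool.cond_false, one_mul, exp_zero]
    exact Ring.mul_inverse_cancel _ hu

/-- Hence, on the one-bond lattice, (29) typed: a (26)-invariant family is constant (= its value at `1`) on the
unitary configurations — an instance of `eq29_of_unitaryGaugeFix` on the one-domain system
`B10Eq61PerSite.unitSys` with `gen = 0`, `dep = univ`, `sp' = ` the unitary configurations. [folklore] -/
example {𝔸 : Type*} [CStarAlgebra 𝔸] (E : B10Eq61PerSite.unitSys.Dom → (Unit → 𝔸) → ℂ)
    (h26 : ∀ X, SiteGaugeInv toyEnds (E X)) :
    ∀ X (φ : Unit → 𝔸), (∀ b, φ b ∈ unitary 𝔸) → E X φ = E X (fun _ => 1) := by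
  intro X φ hφ
  have h := eq29_of_unitaryGaugeFix (D := B10Eq61PerSite.unitSys) toyEnds
    (sp' := fun _ => {φ | ∀ b, φ b ∈ unitary 𝔸}) (E := E) (gen := fun _ _ _ => 0) (dep := fun _ => univ)
    (fun X V V' hVV' => by rw [show V = V' from funext fun b => hVV' b (mem_univ b)])
    h26 (fun X φ hφ => hφ) (fun X φ hφ => toy_axial_gaugeFix φ hφ) X φ hφ
  rw [h, expLine_one_one]
  simp

end Toys

end Literature.MathematicalPhysics.QuantumFieldTheory.Balaban1983to89.B10Eq26SiteGauge
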